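import Literature.MathematicalPhysics.QuantumFieldTheory.Balaban1983to89.HaarExpChartChangeOfVariables
import Summits.QuantumFields.YangMills.Theorems.BalabanUVNodesN08HaarCompatibilityGuardChartTransfer

/-!
# BalabanUVNodes ∕ N08 — THE INTRINSIC HAAR JACOBIAN OF A GROUP MAP IN THE EXPONENTIAL CHART IS `|det|` OF ITS LEFT-TRIVIALISED
# TANGENT MAP; THE QUANTITATIVE «LEMMA A» (push-forward `≤ K·Haar`) FROM A JACOBIAN FLOOR ON WINDOWS, FOR EVERY LOG-CHARTED COMPACT GROUP

WIDTH SEAT `pub-ymgap-dag-n08-w6` g5 (harness re-seat №5), item-3 lineage of the N08 Haar-compatibility files, 2026-08-28.  DAG node N08 =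
[Balaban1985UV3] Thm 1 p. 257 (compact) + Thm 2 p. 272; the typed (0.4) averaging and its guard = [Balaban1987RG1] (0.4) p. 253; key item K1⁷
`StabilityBAtRecordR13SepCoPH` (stmt-QuantumFields-20542), `--supports … --as helper`.  COUNT-NEUTRAL.

THE POINT.  Part 20 (`…GuardOneStepBound`) bounds the one-step transport of the typed (0.4) averaging modulo the per-fibre hypothesis (H_K)
«guard-admitting fibre laws `≤ K·Haar`», part 24 (`…GuardFibreCore`) reduces (H_K) to the lattice-free core map, and n08-w3 g5's part 27C
(`…GuardCoreLawSU2`) DISCHARGES it at `N = 2` on the range `L^{d−1} ≤ 9` through the quaternion model of `SU(2)`.  For GENERAL `N` (and without the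
range) the map-independent engine is the change of variables for Haar measure in EXPONENTIAL COORDINATES of dag-n09-w4's
`HaarExpChartChangeOfVariables` (§3–§4 there: for a map `Ψ` of a compact group `G` faithfully represented on a log-charted linear group, reading
`ψ` in the chart `Θ` on `Ω`, `μ⌊Ψ(ΘΩ) = Ψ_*(J_Ψ · μ⌊ΘΩ)` with `J_Ψ(g) = |det jac(ψ(Λg))|·|det ψ′(Λg)|∕|det jac(Λg)|`).  THIS FILE adds the two
[folklore] facts that turn it into a DENSITY BOUND:
 §1 ★★★ `jac_apply_fderiv_eq_leftTangent` ∕ `det_jac_mul_det_fderiv_eq` ∕ `jacobian_eq_abs_det_leftTangent` — THE CHART FACTORS CANCEL: if the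
    ambient expression `K♯` of `Ψ` (`K♯(e^X) = ρ(Ψ(Θ X))` on an OPEN `Ω`) has a Fréchet derivative `D` at `e^X`, then for EVERY real-linear
    endomorphism `T` of `𝔤` with `↑(T v) = e^{−ψX}·D(e^X·↑v)` (the LEFT-TRIVIALISED TANGENT MAP of `Ψ` at `Θ X`, read through the faithful
    representation) one has `jac(ψX) ∘ ψ′(X) = T ∘ jac(X)`, hence `det jac(ψX)·det ψ′(X) = det T·det jac(X)` and **`J_Ψ(Θ X) = |det T|`** —
    the Haar Jacobian is INTRINSIC (chain rule on `e^{ψ Y} = K♯(e^{Y})` near `X`, uniqueness of the derivative, `d exp_X = L_{e^X} ∘ jac X` =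
    r10's `B13HaarSigmaJacobian.hasFDerivAt_expChart`);
 §2 ★★ `mul_haar_inter_preimage_le_of_jacobian_ge` — THE QUANTITATIVE LEMMA A ON ONE WINDOW: a floor `m ≤ J_Ψ` on `Θ(Ω)` gives
    `m·μ(Θ(Ω) ∩ Ψ⁻¹A) ≤ μ(A)` for every Borel `A` (n09-w4's measure form + monotonicity of `withDensity`), i.e. `(μ⌊Θ(Ω)).map Ψ ≤ m⁻¹•μ`; and its
    LEFT-TRANSLATED edition `mul_haar_translate_inter_preimage_le` for a window `w₀·Θ(Ω)` of a map `Φ` with `Φ(w₀ g) = w₁·Ψ(g)` (left invariance);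
 §3 ★★ `haar_map_le_of_windows` — THE FRAME FOR EVERY `G`: finitely many translated windows with chart conjugates (`ψ_k`, `ψ_k′`, `InjOn`, `MapsTo`,
    Jacobian floor `m`) covering a measurable `S`, `Φ = τ` off `S` with `μ∘τ⁻¹ ≤ μ` ⇒ **`μ∘Φ⁻¹ ≤ (m⁻¹·#K + 1)•μ`** (part 21's generic §Pieces
    `mul_measure_inter_preimage_le_card_mul` ∕ `map_restrict_le_smul` ∕ `map_le_smul_of_restrict` BY IMPORT) — the shape of (H_K) ∕ (H_K-core) with
    `K = m⁻¹·#windows + 1`; `exists_finset_cover_translate_window`: a compact `G` is covered by finitely many translates of any chart window.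
What it does NOT supply (successor files of this seat): the chart conjugates of the printed core map `Kmat` at guarded fibres (derivative within the
window, `MapsTo`, injectivity = p626433 `uniform_injectivity_windows`) and its floor (`|det T| ≥ (1 − Σcᵢ)^{N²−1}` = p621515
`abs_det_leftTangentSU_pinch` through §1).

HONEST FRAMING.  [folklore] calculus ∕ measure theory over lit-balaban's exponential charts (`IsChartRep`, [Helgason2000] Ch. I §1 Thm. 1.14) and
dag-n09-w4's change of variables BY IMPORT; nothing of Bałaban's asserted; NO window, chart conjugate or floor of the printed fibre map is constructed
here; (H_K) ∕ (H_K-core) NOT discharged here; E6′ NOT decided; `hmass` NOT supplied; count-neutral; N08 NOT discharged; counts unmoved (typed 28∕28 ·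
discharged 5∕27); one finite 𝕋⁴ programme at fixed ε — R4 closes the CONDITIONAL rung `BalabanLadder.UV` only; the Yang–Mills mass gap (Clay) is NOT
proved; nothing continuum ∕ OS.  0 `sorry`, 0 `def`, standard axioms.
-/

noncomputable section

open NormedSpace Set Function Filter Topology MeasureTheory
open scoped ENNReal NNReal

namespace Summit.QuantumFields.YangMills.BalabanUVNodes.N08HaarCompatibilityGuardIntrinsicJacobian

open Literature.MathematicalPhysics.QuantumFieldTheory.Balaban1983to89
open Literature.MathematicalPhysics.QuantumFieldTheory.Balaban1983to89.HaarExponentialChart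
open Literature.MathematicalPhysics.QuantumFieldTheory.Balaban1983to89.HaarExponentialChart.IsChartRep (chartRadius innerRadius)
open Literature.MathematicalPhysics.QuantumFieldTheory.Balaban1983to89.B13HaarSigmaJacobian (jac hasFDerivAt_expChart)
open Literature.Analysis.Calculus.ExpDifferential (exp_neg_mul_exp_eq_one)
open Summit.QuantumFields.YangMills.BalabanUVNodes.N08HaarCompatibilityGuardChartTransfer
  (mul_measure_inter_preimage_le_card_mul map_restrict_le_smul map_le_smul_of_restrict)

/-! ## §1 The Haar Jacobian in the exponential chart is `|det|` of the left-trivialised tangent map -/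

section Calculus

variable {𝔸 : Type*} [NormedRing 𝔸] [NormedAlgebra ℂ 𝔸] [CompleteSpace 𝔸]
variable {G : Type*} [Group G] [TopologicalSpace G]
variable {C : LogChart 𝔸} {ρ : G →* 𝔸} (h : IsChartRep C ρ) [FiniteDimensional ℝ C.lie]
  (hlie : ∀ x ∈ C.lie, ∀ y ∈ C.lie, x * y - y * x ∈ C.lie)

/-- **`d exp_X = L_{e^X} ∘ jac X` ON `𝔤`**: the map `𝔤 → 𝔸`, `Y ↦ e^{Y}`, has Fréchet derivative `v ↦ e^X · jac(X) v` at `X` (r10's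
`hasFDerivAt_expChart`, un-trivialised). [cite: Helgason2000, Ch. I §1 Thm. 1.14 (12) p. 96] -/
theorem hasFDerivAt_coe_exp (X : C.lie) :
    HasFDerivAt (fun Y : C.lie => exp ((Y : C.lie) : 𝔸))
      ((ContinuousLinearMap.mul ℝ 𝔸 (exp ((X : C.lie) : 𝔸))).comp (C.lie.subtypeL.comp (jac hlie X))) X := by
  have h1 := ((ContinuousLinearMap.mul ℝ 𝔸 (exp ((X : C.lie) : 𝔸))).hasFDerivAt).comp X (hasFDerivAt_expChart hlie X)
  refine h1.congr_of_eventuallyEq (Eventually.of_forall fun Y => ?_)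
  simp only [Function.comp_apply, ContinuousLinearMap.mul_apply', ← mul_assoc,
    Literature.Analysis.Calculus.ExpDifferential.exp_mul_exp_neg_eq_one (𝕂 := ℂ), one_mul]

/-- ★★★ **THE CHART FACTORS CANCEL.**  Let `Ω ⊆ 𝔤` be OPEN, `X ∈ Ω`, `ψ : 𝔤 → 𝔤` with derivative `ψ′` within `Ω` at `X`, `Ψ : G → G` reading `ψ` in the
chart on `Ω` (`Ψ(Θ Y) = Θ(ψ Y)`), and let `K♯ : 𝔸 → 𝔸` be an ambient expression of `Ψ` on `Θ(Ω)` (`K♯(e^Y) = ρ(Ψ(Θ Y))`, `Y ∈ Ω`) with a Fréchet derivative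
`D` at `e^X`.  Then for EVERY real-linear `T : 𝔤 → 𝔤` with `↑(T v) = e^{−ψ X} · D(e^X · ↑v)` — the left-trivialised tangent map of `Ψ` at `Θ X` —
**`jac(ψ X)(ψ′ v) = T(jac(X) v)`** for all `v ∈ 𝔤` (differentiate `e^{ψ Y} = K♯(e^Y)` at `Y = X`; uniqueness of the derivative).
[cite: Helgason2000, Ch. I §1 Thm. 1.14 (12) p. 96] -/
theorem jac_apply_fderiv_eq_leftTangent {Ω : Set C.lie} (hΩo : IsOpen Ω) {X : C.lie} (hX : X ∈ Ω)
    {ψ : C.lie → C.lie} {ψ'X : C.lie →L[ℝ] C.lie} (hψ' : HasFDerivWithinAt ψ ψ'X Ω X)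
    {Ψ : G → G} (hΨ : ∀ Y ∈ Ω, Ψ (h.expChart Y) = h.expChart (ψ Y))
    {K : 𝔸 → 𝔸} {D : 𝔸 →L[ℝ] 𝔸} (hK : HasFDerivAt K D (exp ((X : C.lie) : 𝔸)))
    (hKρ : ∀ Y ∈ Ω, K (exp ((Y : C.lie) : 𝔸)) = ρ (Ψ (h.expChart Y)))
    {T : C.lie →ₗ[ℝ] C.lie} (hT : ∀ v : C.lie, ((T v : C.lie) : 𝔸) = exp (-((ψ X : C.lie) : 𝔸)) * D (exp ((X : C.lie) : 𝔸) * (v : 𝔸)))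
    (v : C.lie) : jac hlie (ψ X) (ψ'X v) = T (jac hlie X v) := by
  have hψX : HasFDerivAt ψ ψ'X X := hψ'.hasFDerivAt (hΩo.mem_nhds hX)
  -- the two derivatives of `Y ↦ e^{ψ Y} = K♯(e^Y)` at `X`
  have h1 : HasFDerivAt (fun Y : C.lie => exp ((ψ Y : C.lie) : 𝔸))
      (((ContinuousLinearMap.mul ℝ 𝔸 (exp ((ψ X : C.lie) : 𝔸))).comp (C.lie.subtypeL.comp (jac hlie (ψ X)))).comp ψ'X) X :=
    (hasFDerivAt_coe_exp hlie (ψ X)).comp X hψX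
  have h2 : HasFDerivAt (fun Y : C.lie => K (exp ((Y : C.lie) : 𝔸)))
      (D.comp ((ContinuousLinearMap.mul ℝ 𝔸 (exp ((X : C.lie) : 𝔸))).comp (C.lie.subtypeL.comp (jac hlie X)))) X :=
    hK.comp X (hasFDerivAt_coe_exp hlie X)
  have heq : (fun Y : C.lie => exp ((ψ Y : C.lie) : 𝔸)) =ᶠ[𝓝 X] fun Y : C.lie => K (exp ((Y : C.lie) : 𝔸)) := by
    filter_upwards [hΩo.mem_nhds hX] with Y hY
    rw [hKρ Y hY, hΨ Y hY, h.rho_expChart]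
  have huniq := h1.unique (h2.congr_of_eventuallyEq heq)
  have happ := congrArg (fun L : C.lie →L[ℝ] 𝔸 => L v) huniq
  simp only [ContinuousLinearMap.comp_apply, ContinuousLinearMap.mul_apply', Submodule.subtypeL_apply] at happ
  -- `happ : e^{ψX} · ↑(jac(ψX)(ψ′ v)) = D(e^X · ↑(jac X v))`
  apply Subtype.ext
  show ((jac hlie (ψ X) (ψ'X v) : C.lie) : 𝔸) = ((T (jac hlie X v) : C.lie) : 𝔸)
  rw [hT, ← happ, ← mul_assoc, exp_neg_mul_exp_eq_one (𝕂 := ℂ), one_mul]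

/-- As LINEAR MAPS: `jac(ψ X) ∘ ψ′ = T ∘ jac(X)`. [cite: Helgason2000, Ch. I §1 Thm. 1.14 (12) p. 96] -/
theorem jac_comp_fderiv_eq_leftTangent_comp_jac {Ω : Set C.lie} (hΩo : IsOpen Ω) {X : C.lie} (hX : X ∈ Ω)
    {ψ : C.lie → C.lie} {ψ'X : C.lie →L[ℝ] C.lie} (hψ' : HasFDerivWithinAt ψ ψ'X Ω X)
    {Ψ : G → G} (hΨ : ∀ Y ∈ Ω, Ψ (h.expChart Y) = h.expChart (ψ Y))
    {K : 𝔸 → 𝔸} {D : 𝔸 →L[ℝ] 𝔸} (hK : HasFDerivAt K D (exp ((X : C.lie) : 𝔸)))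
    (hKρ : ∀ Y ∈ Ω, K (exp ((Y : C.lie) : 𝔸)) = ρ (Ψ (h.expChart Y)))
    {T : C.lie →ₗ[ℝ] C.lie} (hT : ∀ v : C.lie, ((T v : C.lie) : 𝔸) = exp (-((ψ X : C.lie) : 𝔸)) * D (exp ((X : C.lie) : 𝔸) * (v : 𝔸))) :
    (jac hlie (ψ X) : C.lie →ₗ[ℝ] C.lie) ∘ₗ (ψ'X : C.lie →ₗ[ℝ] C.lie) = T ∘ₗ (jac hlie X : C.lie →ₗ[ℝ] C.lie) := by
  ext v
  exact congrArg Subtype.val (jac_apply_fderiv_eq_leftTangent h hlie hΩo hX hψ' hΨ hK hKρ hT v)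

/-- ★★ **DETERMINANTS**: `det jac(ψ X) · det ψ′(X) = det T · det jac(X)`. [cite: Helgason2000, Ch. I §1 Thm. 1.14 (12) p. 96] -/
theorem det_jac_mul_det_fderiv_eq {Ω : Set C.lie} (hΩo : IsOpen Ω) {X : C.lie} (hX : X ∈ Ω)
    {ψ : C.lie → C.lie} {ψ'X : C.lie →L[ℝ] C.lie} (hψ' : HasFDerivWithinAt ψ ψ'X Ω X)
    {Ψ : G → G} (hΨ : ∀ Y ∈ Ω, Ψ (h.expChart Y) = h.expChart (ψ Y))
    {K : 𝔸 → 𝔸} {D : 𝔸 →L[ℝ] 𝔸} (hK : HasFDerivAt K D (exp ((X : C.lie) : 𝔸)))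
    (hKρ : ∀ Y ∈ Ω, K (exp ((Y : C.lie) : 𝔸)) = ρ (Ψ (h.expChart Y)))
    {T : C.lie →ₗ[ℝ] C.lie} (hT : ∀ v : C.lie, ((T v : C.lie) : 𝔸) = exp (-((ψ X : C.lie) : 𝔸)) * D (exp ((X : C.lie) : 𝔸) * (v : 𝔸))) :
    LinearMap.det (jac hlie (ψ X) : C.lie →ₗ[ℝ] C.lie) * (ψ'X).det =
      LinearMap.det T * LinearMap.det (jac hlie X : C.lie →ₗ[ℝ] C.lie) := by
  have hc := jac_comp_fderiv_eq_leftTangent_comp_jac h hlie hΩo hX hψ' hΨ hK hKρ hT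
  have := congrArg LinearMap.det hc
  rwa [LinearMap.det_comp, LinearMap.det_comp] at this

/-- ★★ **THE DETERMINANT OF THE CHART CONJUGATE**: where `det jac(ψ X) ≠ 0`, `det ψ′(X) = det T · det jac(X) ∕ det jac(ψ X)`.
[cite: Helgason2000, Ch. I §1 Thm. 1.14 (12) p. 96] -/
theorem det_fderiv_eq {Ω : Set C.lie} (hΩo : IsOpen Ω) {X : C.lie} (hX : X ∈ Ω)
    {ψ : C.lie → C.lie} {ψ'X : C.lie →L[ℝ] C.lie} (hψ' : HasFDerivWithinAt ψ ψ'X Ω X)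
    {Ψ : G → G} (hΨ : ∀ Y ∈ Ω, Ψ (h.expChart Y) = h.expChart (ψ Y))
    {K : 𝔸 → 𝔸} {D : 𝔸 →L[ℝ] 𝔸} (hK : HasFDerivAt K D (exp ((X : C.lie) : 𝔸)))
    (hKρ : ∀ Y ∈ Ω, K (exp ((Y : C.lie) : 𝔸)) = ρ (Ψ (h.expChart Y)))
    {T : C.lie →ₗ[ℝ] C.lie} (hT : ∀ v : C.lie, ((T v : C.lie) : 𝔸) = exp (-((ψ X : C.lie) : 𝔸)) * D (exp ((X : C.lie) : 𝔸) * (v : 𝔸)))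
    (hjacψ : LinearMap.det (jac hlie (ψ X) : C.lie →ₗ[ℝ] C.lie) ≠ 0) :
    (ψ'X).det = LinearMap.det T * LinearMap.det (jac hlie X : C.lie →ₗ[ℝ] C.lie) /
      LinearMap.det (jac hlie (ψ X) : C.lie →ₗ[ℝ] C.lie) := by
  rw [eq_div_iff hjacψ, mul_comm ((ψ'X).det)]
  exact det_jac_mul_det_fderiv_eq h hlie hΩo hX hψ' hΨ hK hKρ hT

/-- ★★★ **THE HAAR JACOBIAN IS `|det T|`**: where `det jac(X) ≠ 0`, dag-n09-w4's Jacobian read at `Θ X` equals `|det T|`: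
`|det jac(ψ X)| · |det ψ′(X)| ∕ |det jac(X)| = |det T|` (in `ℝ≥0∞`, with `jacDensity = |det jac|`). [cite: Helgason2000, Ch. I §1 Thm. 1.14 (12) p. 96] -/
theorem jacobian_eq_abs_det_leftTangent {Ω : Set C.lie} (hΩo : IsOpen Ω) {X : C.lie} (hX : X ∈ Ω)
    {ψ : C.lie → C.lie} {ψ'X : C.lie →L[ℝ] C.lie} (hψ' : HasFDerivWithinAt ψ ψ'X Ω X)
    {Ψ : G → G} (hΨ : ∀ Y ∈ Ω, Ψ (h.expChart Y) = h.expChart (ψ Y))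
    {K : 𝔸 → 𝔸} {D : 𝔸 →L[ℝ] 𝔸} (hK : HasFDerivAt K D (exp ((X : C.lie) : 𝔸)))
    (hKρ : ∀ Y ∈ Ω, K (exp ((Y : C.lie) : 𝔸)) = ρ (Ψ (h.expChart Y)))
    {T : C.lie →ₗ[ℝ] C.lie} (hT : ∀ v : C.lie, ((T v : C.lie) : 𝔸) = exp (-((ψ X : C.lie) : 𝔸)) * D (exp ((X : C.lie) : 𝔸) * (v : 𝔸)))
    (hjacX : LinearMap.det (jac hlie X : C.lie →ₗ[ℝ] C.lie) ≠ 0) :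
    jacDensity hlie (ψ X) * ENNReal.ofReal |(ψ'X).det| / jacDensity hlie X = ENNReal.ofReal |LinearMap.det T| := by
  have hprod := det_jac_mul_det_fderiv_eq h hlie hΩo hX hψ' hΨ hK hKρ hT
  have habs : |LinearMap.det (jac hlie (ψ X) : C.lie →ₗ[ℝ] C.lie)| * |(ψ'X).det| =
      |LinearMap.det T| * |LinearMap.det (jac hlie X : C.lie →ₗ[ℝ] C.lie)| := by
    rw [← abs_mul, ← abs_mul, hprod]
  have hX0 : ENNReal.ofReal |LinearMap.det (jac hlie X : C.lie →ₗ[ℝ] C.lie)| ≠ 0 := by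
    rw [Ne, ENNReal.ofReal_eq_zero, not_le]; exact abs_pos.2 hjacX
  rw [jacDensity_def, jacDensity_def, ← ENNReal.ofReal_mul (abs_nonneg _), habs, ENNReal.ofReal_mul (abs_nonneg _),
    mul_div_assoc, ENNReal.div_self hX0 ENNReal.ofReal_ne_top, mul_one]

/-- **FAMILY FORM along `Θ(Ω)`**: if at every `X ∈ Ω` the hypotheses hold with ambient derivatives `D X` and left-trivialised tangent maps `T X`, then
dag-n09-w4's Jacobian `J_Ψ(g) = |det jac(ψ(Λ g))|·|det ψ′(Λ g)|∕|det jac(Λ g)|` equals `|det T(Λ g)|` at every `g ∈ Θ(Ω)` (`Ω ⊆ B(0,s)`, `s ≤ s_C`, so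
`Λ(Θ X) = X`). [cite: Helgason2000, Ch. I §1 Thm. 1.14 (12)–(13) p. 96] -/
theorem jacobian_eq_abs_det_leftTangent_of_mem_image {s : ℝ} (hs : s ≤ chartRadius C) {Ω : Set C.lie} (hΩo : IsOpen Ω)
    (hΩs : Ω ⊆ Metric.ball (0 : C.lie) s) (hjac : ∀ X ∈ Ω, LinearMap.det (jac hlie X : C.lie →ₗ[ℝ] C.lie) ≠ 0)
    {ψ : C.lie → C.lie} {ψ' : C.lie → C.lie →L[ℝ] C.lie} (hψ' : ∀ X ∈ Ω, HasFDerivWithinAt ψ (ψ' X) Ω X)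
    {Ψ : G → G} (hΨ : ∀ Y ∈ Ω, Ψ (h.expChart Y) = h.expChart (ψ Y))
    {K : 𝔸 → 𝔸} {D : C.lie → 𝔸 →L[ℝ] 𝔸} (hK : ∀ X ∈ Ω, HasFDerivAt K (D X) (exp ((X : C.lie) : 𝔸)))
    (hKρ : ∀ Y ∈ Ω, K (exp ((Y : C.lie) : 𝔸)) = ρ (Ψ (h.expChart Y)))
    {T : C.lie → C.lie →ₗ[ℝ] C.lie}
    (hT : ∀ X ∈ Ω, ∀ v : C.lie, ((T X v : C.lie) : 𝔸) = exp (-((ψ X : C.lie) : 𝔸)) * D X (exp ((X : C.lie) : 𝔸) * (v : 𝔸)))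
    {g : G} (hg : g ∈ h.expChart '' Ω) :
    jacDensity hlie (ψ (h.logChart g)) * ENNReal.ofReal |(ψ' (h.logChart g)).det| / jacDensity hlie (h.logChart g) =
      ENNReal.ofReal |LinearMap.det (T (h.logChart g))| := by
  obtain ⟨X, hX, rfl⟩ := hg
  have hXs : ‖X‖ < chartRadius C := lt_of_lt_of_le (mem_ball_zero_iff.1 (hΩs hX)) hs
  rw [h.logChart_expChart hXs]
  exact jacobian_eq_abs_det_leftTangent h hlie hΩo hX (hψ' X hX) hΨ (hK X hX) hKρ (hT X hX) (hjac X hX)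

end Calculus

/-! ## §2 The quantitative Lemma A on one window: a Jacobian floor bounds the push-forward by `m⁻¹·Haar` -/

section Window

variable {𝔸 : Type*} [NormedRing 𝔸] [NormedAlgebra ℂ 𝔸] [CompleteSpace 𝔸]
variable {G : Type*} [Group G] [TopologicalSpace G] [IsTopologicalGroup G] [CompactSpace G]
variable {C : LogChart 𝔸} {ρ : G →* 𝔸} (h : IsChartRep C ρ) [FiniteDimensional ℝ C.lie]
  (hlie : ∀ x ∈ C.lie, ∀ y ∈ C.lie, x * y - y * x ∈ C.lie)
variable [MeasurableSpace C.lie] [BorelSpace C.lie]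
variable [MeasurableSpace G] [BorelSpace G] (μ : Measure G) [μ.IsHaarMeasure]

/-- ★★ **THE QUANTITATIVE LEMMA A ON ONE WINDOW (set-wise).**  Under the hypotheses of dag-n09-w4's
`haar_restrict_image_eq_map_withDensity_jacobian` (`0 < s ≤ s_C`, Borel `Ω ⊆ B(0,s)` with `det jac ≠ 0`, `ψ` injective on `Ω` with a derivative `ψ′` within
`Ω`, `ψ(Ω) ⊆ B(0,s)`, `Ψ(Θ X) = Θ(ψ X)` on `Ω`), a Borel `Ψ`, and a FLOOR `m ≤ J_Ψ(Θ X)` for `X ∈ Ω`:  **`m · μ(Θ(Ω) ∩ Ψ⁻¹A) ≤ μ(A)`** for every Borel `A`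
(`μ(A) ≥ μ(A ∩ Ψ(ΘΩ)) = ∫_{ΘΩ ∩ Ψ⁻¹A} J_Ψ dμ ≥ m·μ(ΘΩ ∩ Ψ⁻¹A)`). [cite: Helgason2000, Ch. I §1 Thm. 1.14 (13) p. 96] -/
theorem mul_haar_inter_preimage_le_of_jacobian_ge {s : ℝ} (hs0 : 0 < s) (hs : s ≤ chartRadius C)
    {Ω : Set C.lie} (hΩ : MeasurableSet Ω) (hΩs : Ω ⊆ Metric.ball (0 : C.lie) s)
    (hjac : ∀ X ∈ Ω, LinearMap.det (jac hlie X : C.lie →ₗ[ℝ] C.lie) ≠ 0)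
    {ψ : C.lie → C.lie} {ψ' : C.lie → C.lie →L[ℝ] C.lie}
    (hψ' : ∀ X ∈ Ω, HasFDerivWithinAt ψ (ψ' X) Ω X) (hψ : Set.InjOn ψ Ω)
    (hψs : Set.MapsTo ψ Ω (Metric.ball (0 : C.lie) s)) {Ψ : G → G} (hΨm : Measurable Ψ)
    (hΨ : ∀ X ∈ Ω, Ψ (h.expChart X) = h.expChart (ψ X)) {m : ℝ≥0∞}
    (hm : ∀ X ∈ Ω, m ≤ jacDensity hlie (ψ X) * ENNReal.ofReal |(ψ' X).det| / jacDensity hlie X)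
    {A : Set G} (hA : MeasurableSet A) :
    m * μ (h.expChart '' Ω ∩ Ψ ⁻¹' A) ≤ μ A := by
  have key := h.haar_restrict_image_eq_map_withDensity_jacobian hlie μ hs0 hs hΩ hΩs hjac hψ' hψ hψs hΨ
  have hΘΩ : MeasurableSet (h.expChart '' Ω) := h.measurableSet_image_expChart hΩ ((h.injOn_expChart hs).mono hΩs)
  have hfloor : ∀ g ∈ h.expChart '' Ω ∩ Ψ ⁻¹' A,
      m ≤ jacDensity hlie (ψ (h.logChart g)) * ENNReal.ofReal |(ψ' (h.logChart g)).det| / jacDensity hlie (h.logChart g) := by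
    rintro g ⟨⟨X, hX, rfl⟩, -⟩
    have hXs : ‖X‖ < chartRadius C := lt_of_lt_of_le (mem_ball_zero_iff.1 (hΩs hX)) hs
    rw [h.logChart_expChart hXs]
    exact hm X hX
  calc m * μ (h.expChart '' Ω ∩ Ψ ⁻¹' A)
      = ∫⁻ _ in h.expChart '' Ω ∩ Ψ ⁻¹' A, m ∂μ := (setLIntegral_const _ _).symm
    _ ≤ ∫⁻ g in h.expChart '' Ω ∩ Ψ ⁻¹' A,
          jacDensity hlie (ψ (h.logChart g)) * ENNReal.ofReal |(ψ' (h.logChart g)).det| / jacDensity hlie (h.logChart g) ∂μ :=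
        setLIntegral_mono' (hΘΩ.inter (hΨm hA)) hfloor
    _ = (Measure.map Ψ ((μ.restrict (h.expChart '' Ω)).withDensity fun g =>
          jacDensity hlie (ψ (h.logChart g)) * ENNReal.ofReal |(ψ' (h.logChart g)).det| / jacDensity hlie (h.logChart g))) A := by
        rw [Measure.map_apply hΨm hA, withDensity_apply _ (hΨm hA), Measure.restrict_restrict (hΨm hA), inter_comm]
    _ = μ.restrict (Ψ '' (h.expChart '' Ω)) A := by rw [← key]
    _ ≤ μ A := by rw [Measure.restrict_apply hA]; exact measure_mono inter_subset_left

/-- … as a MEASURE inequality: `(μ⌊Θ(Ω)).map Ψ ≤ m⁻¹ • μ` (`0 < m < ∞`). [cite: Helgason2000, Ch. I §1 Thm. 1.14 (13) p. 96] -/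
theorem map_restrict_image_le_smul_of_jacobian_ge {s : ℝ} (hs0 : 0 < s) (hs : s ≤ chartRadius C)
    {Ω : Set C.lie} (hΩ : MeasurableSet Ω) (hΩs : Ω ⊆ Metric.ball (0 : C.lie) s)
    (hjac : ∀ X ∈ Ω, LinearMap.det (jac hlie X : C.lie →ₗ[ℝ] C.lie) ≠ 0)
    {ψ : C.lie → C.lie} {ψ' : C.lie → C.lie →L[ℝ] C.lie}
    (hψ' : ∀ X ∈ Ω, HasFDerivWithinAt ψ (ψ' X) Ω X) (hψ : Set.InjOn ψ Ω)
    (hψs : Set.MapsTo ψ Ω (Metric.ball (0 : C.lie) s)) {Ψ : G → G} (hΨm : Measurable Ψ)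
    (hΨ : ∀ X ∈ Ω, Ψ (h.expChart X) = h.expChart (ψ X)) {m : ℝ≥0∞} (hm0 : m ≠ 0) (hmt : m ≠ ∞)
    (hm : ∀ X ∈ Ω, m ≤ jacDensity hlie (ψ X) * ENNReal.ofReal |(ψ' X).det| / jacDensity hlie X) :
    (μ.restrict (h.expChart '' Ω)).map Ψ ≤ m⁻¹ • μ := by
  have := map_restrict_le_smul μ hΨm (S := h.expChart '' Ω) (c := 1) hm0 hmt fun A hA => by
    rw [one_mul]; exact mul_haar_inter_preimage_le_of_jacobian_ge h hlie μ hs0 hs hΩ hΩs hjac hψ' hψ hψs hΨm hΨ hm hA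
  rwa [mul_one] at this

/-- ★★ **THE LEFT-TRANSLATED WINDOW.**  For a Borel map `Φ : G → G` and `w₀, w₁ ∈ G`, put `Ψ(g) := w₁⁻¹·Φ(w₀·g)`; if `Ψ` satisfies the hypotheses
of `mul_haar_inter_preimage_le_of_jacobian_ge` on `Ω`, then on the TRANSLATED window `w₀·Θ(Ω) = {x | w₀⁻¹x ∈ Θ(Ω)}`:
**`m · μ(w₀·Θ(Ω) ∩ Φ⁻¹A) ≤ μ(A)`** for every Borel `A` (left invariance of `μ` twice). [cite: Helgason2000, Ch. I §1 Thm. 1.14 (13) p. 96] -/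
theorem mul_haar_translate_inter_preimage_le {s : ℝ} (hs0 : 0 < s) (hs : s ≤ chartRadius C)
    {Ω : Set C.lie} (hΩ : MeasurableSet Ω) (hΩs : Ω ⊆ Metric.ball (0 : C.lie) s)
    (hjac : ∀ X ∈ Ω, LinearMap.det (jac hlie X : C.lie →ₗ[ℝ] C.lie) ≠ 0)
    {Φ : G → G} (hΦm : Measurable Φ) (w₀ w₁ : G)
    {ψ : C.lie → C.lie} {ψ' : C.lie → C.lie →L[ℝ] C.lie}
    (hψ' : ∀ X ∈ Ω, HasFDerivWithinAt ψ (ψ' X) Ω X) (hψ : Set.InjOn ψ Ω)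
    (hψs : Set.MapsTo ψ Ω (Metric.ball (0 : C.lie) s))
    (hΨ : ∀ X ∈ Ω, w₁⁻¹ * Φ (w₀ * h.expChart X) = h.expChart (ψ X)) {m : ℝ≥0∞}
    (hm : ∀ X ∈ Ω, m ≤ jacDensity hlie (ψ X) * ENNReal.ofReal |(ψ' X).det| / jacDensity hlie X)
    {A : Set G} (hA : MeasurableSet A) :
    m * μ ((fun x => w₀⁻¹ * x) ⁻¹' (h.expChart '' Ω) ∩ Φ ⁻¹' A) ≤ μ A := by
  have hΨm : Measurable fun g => w₁⁻¹ * Φ (w₀ * g) := (hΦm.comp (measurable_const_mul w₀)).const_mul _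
  have hB : MeasurableSet ((fun y => w₁ * y) ⁻¹' A) := measurable_const_mul w₁ hA
  -- the translated piece is the left translate by `w₀` of the piece of `Ψ` for the target set `w₁⁻¹·A`
  have hset : (fun x => w₀⁻¹ * x) ⁻¹' (h.expChart '' Ω) ∩ Φ ⁻¹' A =
      (fun x => w₀⁻¹ * x) ⁻¹' (h.expChart '' Ω ∩ (fun g => w₁⁻¹ * Φ (w₀ * g)) ⁻¹' ((fun y => w₁ * y) ⁻¹' A)) := by
    ext x
    simp only [mem_inter_iff, mem_preimage, mul_inv_cancel_left]
  rw [hset, measure_preimage_mul]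
  calc m * μ (h.expChart '' Ω ∩ (fun g => w₁⁻¹ * Φ (w₀ * g)) ⁻¹' ((fun y => w₁ * y) ⁻¹' A))
      ≤ μ ((fun y => w₁ * y) ⁻¹' A) :=
        mul_haar_inter_preimage_le_of_jacobian_ge h hlie μ hs0 hs hΩ hΩs hjac hψ' hψ hψs hΨm hΨ hm hB
    _ = μ A := measure_preimage_mul μ w₁ A

end Window

/-! ## §3 The frame for every log-charted compact group: windows add up, identity off the guard -/

section Frame

variable {𝔸 : Type*} [NormedRing 𝔸] [NormedAlgebra ℂ 𝔸] [CompleteSpace 𝔸]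
variable {G : Type*} [Group G] [TopologicalSpace G] [IsTopologicalGroup G] [CompactSpace G]
variable {C : LogChart 𝔸} {ρ : G →* 𝔸} (h : IsChartRep C ρ) [FiniteDimensional ℝ C.lie]
  (hlie : ∀ x ∈ C.lie, ∀ y ∈ C.lie, x * y - y * x ∈ C.lie)

omit [FiniteDimensional ℝ C.lie] in
/-- **A COMPACT GROUP IS COVERED BY FINITELY MANY TRANSLATES OF ANY CHART WINDOW**: for `0 < r ≤ s_C` there is a finite `t ⊆ G` with
`G = ⋃_{w ∈ t} w·Θ(B(0,r))` (the windows `w·V_r` are open — `isOpen_window` — and contain `w`). [cite: Helgason2000, Ch. I §1 Thm. 1.14 (13) p. 96] -/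
theorem exists_finset_cover_translate_window {r : ℝ} (hr0 : 0 < r) (hr : r ≤ chartRadius C) :
    ∃ t : Finset G, ∀ x : G, ∃ w ∈ t, w⁻¹ * x ∈ h.window r := by
  have hopen : ∀ w : G, IsOpen ((fun x => w⁻¹ * x) ⁻¹' h.window r) := fun w =>
    (h.isOpen_window hr).preimage (continuous_const_mul w⁻¹)
  obtain ⟨t, ht⟩ := isCompact_univ.elim_finite_subcover (fun w : G => (fun x => w⁻¹ * x) ⁻¹' h.window r) hopen
    fun x _ => mem_iUnion.2 ⟨x, by simpa using h.one_mem_window hr0⟩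
  refine ⟨t, fun x => ?_⟩
  obtain ⟨w, hw⟩ := mem_iUnion.1 (ht (mem_univ x))
  obtain ⟨hwt, hx⟩ := mem_iUnion.1 hw
  exact ⟨w, hwt, hx⟩

variable [MeasurableSpace C.lie] [BorelSpace C.lie]
variable [MeasurableSpace G] [BorelSpace G] (μ : Measure G) [μ.IsHaarMeasure]

/-- ★★ **THE FRAME FOR EVERY LOG-CHARTED COMPACT GROUP** (the general-group edition of part 21's `haar_map_le_of_windows`, which is the `SU(2)`
Pauli-chart instance).  Let `Φ : G → G` be Borel; `S ⊆ G` measurable, off which `Φ` agrees with a Borel `τ` with `μ∘τ⁻¹ ≤ μ`; and let `S` be covered by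
finitely many TRANSLATED WINDOWS `w₀(k)·Θ(Ω_k)`, `k ∈ K` (`Ω_k ⊆ B(0,s)` Borel with `det jac ≠ 0`, `0 < s ≤ s_C`), on each of which the conjugate
`Ψ_k(g) = w₁(k)⁻¹·Φ(w₀(k)·g)` reads an injective `ψ_k` differentiable within `Ω_k` with `ψ_k(Ω_k) ⊆ B(0,s)` and the COMMON JACOBIAN FLOOR
`m ≤ J_{Ψ_k}(Θ X)` on `Ω_k`, `0 < m < ∞`.  Then **`μ∘Φ⁻¹ ≤ (m⁻¹·#K + 1)•μ`** — the shape of (H_K) ∕ (H_K-core) with `K = m⁻¹·#windows + 1`.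
[cite: Helgason2000, Ch. I §1 Thm. 1.14 (13) p. 96] [cite: Balaban1987RG1, (0.4) p.253 (the consumer's shape; bookkeeping)] -/
theorem haar_map_le_of_windows {Φ τ : G → G} (hΦm : Measurable Φ) (hτ : Measurable τ) (hτμ : μ.map τ ≤ μ)
    {S : Set G} (hSm : MeasurableSet S) (heq : ∀ x, x ∉ S → Φ x = τ x)
    {s : ℝ} (hs0 : 0 < s) (hs : s ≤ chartRadius C)
    {ι : Type*} (K : Finset ι) (w₀ w₁ : ι → G) (Ω : ι → Set C.lie)
    (hΩ : ∀ k ∈ K, MeasurableSet (Ω k)) (hΩs : ∀ k ∈ K, Ω k ⊆ Metric.ball (0 : C.lie) s)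
    (hjac : ∀ k ∈ K, ∀ X ∈ Ω k, LinearMap.det (jac hlie X : C.lie →ₗ[ℝ] C.lie) ≠ 0)
    (ψ : ι → C.lie → C.lie) (ψ' : ι → C.lie → C.lie →L[ℝ] C.lie)
    (hψ' : ∀ k ∈ K, ∀ X ∈ Ω k, HasFDerivWithinAt (ψ k) (ψ' k X) (Ω k) X) (hψ : ∀ k ∈ K, Set.InjOn (ψ k) (Ω k))
    (hψs : ∀ k ∈ K, Set.MapsTo (ψ k) (Ω k) (Metric.ball (0 : C.lie) s))
    (hΨ : ∀ k ∈ K, ∀ X ∈ Ω k, (w₁ k)⁻¹ * Φ (w₀ k * h.expChart X) = h.expChart (ψ k X))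
    {m : ℝ≥0∞} (hm0 : m ≠ 0) (hmt : m ≠ ∞)
    (hm : ∀ k ∈ K, ∀ X ∈ Ω k, m ≤ jacDensity hlie (ψ k X) * ENNReal.ofReal |(ψ' k X).det| / jacDensity hlie X)
    (hS : S ⊆ ⋃ k ∈ K, (fun x => (w₀ k)⁻¹ * x) ⁻¹' (h.expChart '' Ω k)) :
    μ.map Φ ≤ (m⁻¹ * K.card + 1) • μ :=
  map_le_smul_of_restrict μ hΦm hτ hτμ hSm heq
    (map_restrict_le_smul μ hΦm hm0 hmt fun _ hA =>
      mul_measure_inter_preimage_le_card_mul μ K (fun k => (fun x => (w₀ k)⁻¹ * x) ⁻¹' (h.expChart '' Ω k))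
        (fun k hk _ hB => mul_haar_translate_inter_preimage_le h hlie μ hs0 hs (hΩ k hk) (hΩs k hk) (hjac k hk) hΦm (w₀ k) (w₁ k)
          (hψ' k hk) (hψ k hk) (hψs k hk) (hΨ k hk) (hm k hk) hB) hS hA)

/-- **THE SAME WITH `τ = id`** (the core map IS the identity off its guard — part 24): `μ∘Φ⁻¹ ≤ (m⁻¹·#K + 1)•μ`.
[cite: Balaban1987RG1, (0.4) p.253 (bookkeeping)] -/
theorem haar_map_le_of_windows_id {Φ : G → G} (hΦm : Measurable Φ)
    {S : Set G} (hSm : MeasurableSet S) (heq : ∀ x, x ∉ S → Φ x = x)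
    {s : ℝ} (hs0 : 0 < s) (hs : s ≤ chartRadius C)
    {ι : Type*} (K : Finset ι) (w₀ w₁ : ι → G) (Ω : ι → Set C.lie)
    (hΩ : ∀ k ∈ K, MeasurableSet (Ω k)) (hΩs : ∀ k ∈ K, Ω k ⊆ Metric.ball (0 : C.lie) s)
    (hjac : ∀ k ∈ K, ∀ X ∈ Ω k, LinearMap.det (jac hlie X : C.lie →ₗ[ℝ] C.lie) ≠ 0)
    (ψ : ι → C.lie → C.lie) (ψ' : ι → C.lie → C.lie →L[ℝ] C.lie)
    (hψ' : ∀ k ∈ K, ∀ X ∈ Ω k, HasFDerivWithinAt (ψ k) (ψ' k X) (Ω k) X) (hψ : ∀ k ∈ K, Set.InjOn (ψ k) (Ω k))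
    (hψs : ∀ k ∈ K, Set.MapsTo (ψ k) (Ω k) (Metric.ball (0 : C.lie) s))
    (hΨ : ∀ k ∈ K, ∀ X ∈ Ω k, (w₁ k)⁻¹ * Φ (w₀ k * h.expChart X) = h.expChart (ψ k X))
    {m : ℝ≥0∞} (hm0 : m ≠ 0) (hmt : m ≠ ∞)
    (hm : ∀ k ∈ K, ∀ X ∈ Ω k, m ≤ jacDensity hlie (ψ k X) * ENNReal.ofReal |(ψ' k X).det| / jacDensity hlie X)
    (hS : S ⊆ ⋃ k ∈ K, (fun x => (w₀ k)⁻¹ * x) ⁻¹' (h.expChart '' Ω k)) :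
    μ.map Φ ≤ (m⁻¹ * K.card + 1) • μ :=
  haar_map_le_of_windows h hlie μ hΦm measurable_id (by rw [Measure.map_id]) hSm heq hs0 hs K w₀ w₁ Ω hΩ hΩs hjac ψ ψ' hψ' hψ hψs hΨ
    hm0 hmt hm hS

end Frame

end Summit.QuantumFields.YangMills.BalabanUVNodes.N08HaarCompatibilityGuardIntrinsicJacobian

end
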